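import Mathlib
import HarnessLib
import Summits.HubbardSuperconductivity.HubbardSuperconductivity.Theorems.KLProgrammeKLRegimeEngineV8DefsQ2

/-!
# K3 ENGINE package, volume threshold v4: `klEngL₄ P R β U := max (klEngL₃ β U) ⌈2^61 · klEngPsq P² · klEngRsq R² · β³ / U⌉₊`
# (token #16 `klEngL₃ ↦ klEngL₄ P R` of the v2 re-registration of the 20437 engine-flow skeleton, plan g17 (R47l)/(R47n))

Cell `gate-hubbard-kl`, seat hubbard-kl-k3c2-p1 g5 (v2 Defs batch; FINDING «(c)-E5-L» by k3c2-p2 g8, KL STATUS 2026-08-27 l.3142, ruling (R47l) l.3147).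

WHY.  The (E2″-F) row at scale `j` carries `eremBar … (j−1)` whose third term is `Q.CL β (j−1) / L`, and
`(klEngQ7 P R).CL β n = 2^60·klEngPsq P²·klEngRsq R²·(β²+1)·4ⁿ`; the B-absorption of stub (c)'s (E5-F)ₙ door needs the ACCUMULATED rows
`Σ_{1≤j≤n} row_j ≤ U/2`, whose `CL`-part is `≤ 2^55·Psq²·Rsq²·β³/L` — NOT small under the registered volume binder `klEngL₃ β U ≤ L`
(`klEngL₃ β U = 2^10(⌈|β|⌉₊+1)²(⌈|U|⁻¹⌉₊+1)²`, `P`,`R`-free).  `EngineP4` has `∃ U₀ L₃ M₃` under `∀ P … ∀ R …`, so a `P,R`-dependent volume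
threshold is SLOT-LEGAL; v2 raises the WITNESS only:

* **`klEngL₄ P R β U := max (klEngL₃ β U) ⌈2^61 · klEngPsq P ^ 2 · klEngRsq R ^ 2 · β ^ 3 / U⌉₊`** (spec of record (R47l), verbatim);
* the #16 lift line of EVERY v1 closer: **`klEngL₃_le_of_klEngL₄_le : klEngL₄ P R β U ≤ L → klEngL₃ β U ≤ L`** (`klEngL₃_le_klEngL₄`);
* the real readings of the new entry: `klEngL4Real P R β U := 2^61 · klEngPsq P² · klEngRsq R² · β³ / U`, `klEngL4Real_le_of_klEngL₄_le`
  (`… ≤ (L : ℝ)`), `mul_le_mul_of_klEngL₄_le` (`0 < U → 2^61·Psq²·Rsq²·β³ ≤ U·L`), and the form the (E5-F)ₙ route consumes,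
  **`beta_cube_div_le_of_klEngL₄_le : 0 < U → klEngL₄ P R β U ≤ L → 2^55·klEngPsq P²·klEngRsq R²·β³/L ≤ U/64`**;
  `pos_of_klEngL₃_le` / `pos_of_klEngL₄_le` (`0 < L`), `le_of_klEngL₄_le` (`β ≤ L`).
The row-sum lemma `sum_CL_div_le_of_klEngL₄_le` (with `n ≤ nScales β + 1`, `klBetaMin ≤ β`) is k3c2-p2's lineage's, next to this file ((R47l) OWNERS).
`klEngM₃ β U L` is unchanged (reads `L`).  Definitions (one closed natural number) + order lemmas; nothing about the model is asserted; nothing asserts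
superconductivity.
-/

noncomputable section

namespace Summit.HubbardSuperconductivity.HubbardSuperconductivity.Theorems.EngineV8

set_option linter.dupNamespace false -- summit = problem name (single-conjunct summit), D-0017

open Real Finset
open Summit.HubbardSuperconductivity.HubbardSuperconductivity.Theorems.KLRegimeSplit

/-- **`klEngL4Real P R β U := 2^61 · klEngPsq P² · klEngRsq R² · β³ / U`** — the real number whose ceiling enters `klEngL₄` (the volume above which the
accumulated finite-volume evaluation errors `Σ_{j<n} Q.CL β j / L` of the (E2″-F) rows are `≤ U/64`). -/
def klEngL4Real (P : SplitConsts) (R : RenConsts) (β U : ℝ) : ℝ := 2 ^ 61 * klEngPsq P ^ 2 * klEngRsq R ^ 2 * β ^ 3 / U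

/-- **`klEngL₄ P R β U` — the engine-flow skeleton's volume threshold, v4 (token #16)**:
`max (klEngL₃ β U) ⌈2^61 · klEngPsq P ^ 2 · klEngRsq R ^ 2 · β ^ 3 / U⌉₊` (spec of record, plan g17 (R47l)). -/
def klEngL₄ (P : SplitConsts) (R : RenConsts) (β U : ℝ) : ℕ := max (klEngL₃ β U) ⌈2 ^ 61 * klEngPsq P ^ 2 * klEngRsq R ^ 2 * β ^ 3 / U⌉₊

/-- `klEngL₄ P R β U = max (klEngL₃ β U) ⌈klEngL4Real P R β U⌉₊` (`rfl`). -/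
theorem klEngL₄_eq (P : SplitConsts) (R : RenConsts) (β U : ℝ) : klEngL₄ P R β U = max (klEngL₃ β U) ⌈klEngL4Real P R β U⌉₊ := rfl

/-- `klEngL₃ β U ≤ klEngL₄ P R β U`. -/
theorem klEngL₃_le_klEngL₄ (P : SplitConsts) (R : RenConsts) (β U : ℝ) : klEngL₃ β U ≤ klEngL₄ P R β U := le_max_left _ _

/-- `⌈klEngL4Real P R β U⌉₊ ≤ klEngL₄ P R β U`. -/
theorem ceil_klEngL4Real_le_klEngL₄ (P : SplitConsts) (R : RenConsts) (β U : ℝ) : ⌈klEngL4Real P R β U⌉₊ ≤ klEngL₄ P R β U := le_max_right _ _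

/-- **THE #16 LIFT LINE**: `klEngL₄ P R β U ≤ L → klEngL₃ β U ≤ L` — every v1 closer's volume hypothesis from the v2 binder (`hL₃ := klEngL₃_le_of_klEngL₄_le hL`). -/
theorem klEngL₃_le_of_klEngL₄_le {P : SplitConsts} {R : RenConsts} {β U : ℝ} {L : ℕ} (h : klEngL₄ P R β U ≤ L) : klEngL₃ β U ≤ L :=
  (klEngL₃_le_klEngL₄ P R β U).trans h

/-- `β ≤ L` under the v2 binder. -/
theorem le_of_klEngL₄_le {P : SplitConsts} {R : RenConsts} {β U : ℝ} {L : ℕ} (h : klEngL₄ P R β U ≤ L) : β ≤ L :=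
  le_of_klEngL₃_le (klEngL₃_le_of_klEngL₄_le h)

/-- `2^10 ≤ klEngL₃ β U` (so any volume above the threshold is positive). -/
theorem two_pow_ten_le_klEngL₃ (β U : ℝ) : 2 ^ 10 ≤ klEngL₃ β U := by
  unfold klEngL₃
  have h1 : 1 ≤ (⌈|β|⌉₊ + 1) ^ 2 := Nat.one_le_pow _ _ (Nat.succ_pos _)
  have h2 : 1 ≤ (⌈|U|⁻¹⌉₊ + 1) ^ 2 := Nat.one_le_pow _ _ (Nat.succ_pos _)
  calc 2 ^ 10 = 2 ^ 10 * 1 * 1 := by norm_num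
    _ ≤ 2 ^ 10 * (⌈|β|⌉₊ + 1) ^ 2 * (⌈|U|⁻¹⌉₊ + 1) ^ 2 := Nat.mul_le_mul (Nat.mul_le_mul_left _ h1) h2

/-- `0 < L` under the v1 binder. -/
theorem pos_of_klEngL₃_le {β U : ℝ} {L : ℕ} (h : klEngL₃ β U ≤ L) : 0 < L :=
  lt_of_lt_of_le (lt_of_lt_of_le (by norm_num) (two_pow_ten_le_klEngL₃ β U)) h

/-- `0 < L` under the v2 binder. -/
theorem pos_of_klEngL₄_le {P : SplitConsts} {R : RenConsts} {β U : ℝ} {L : ℕ} (h : klEngL₄ P R β U ≤ L) : 0 < L :=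
  pos_of_klEngL₃_le (klEngL₃_le_of_klEngL₄_le h)

/-- **The real reading of the new entry**: `klEngL₄ P R β U ≤ L → 2^61·klEngPsq P²·klEngRsq R²·β³/U ≤ L`. -/
theorem klEngL4Real_le_of_klEngL₄_le {P : SplitConsts} {R : RenConsts} {β U : ℝ} {L : ℕ} (h : klEngL₄ P R β U ≤ L) :
    klEngL4Real P R β U ≤ (L : ℝ) := by
  have h1 : klEngL4Real P R β U ≤ (⌈klEngL4Real P R β U⌉₊ : ℝ) := Nat.le_ceil _
  have h2 : ((⌈klEngL4Real P R β U⌉₊ : ℕ) : ℝ) ≤ (L : ℝ) := by exact_mod_cast (ceil_klEngL4Real_le_klEngL₄ P R β U).trans h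
  exact h1.trans h2

/-- The same with the numerator cleared: `0 < U → klEngL₄ P R β U ≤ L → 2^61·klEngPsq P²·klEngRsq R²·β³ ≤ U·L`. -/
theorem mul_le_mul_of_klEngL₄_le {P : SplitConsts} {R : RenConsts} {β U : ℝ} {L : ℕ} (hU : 0 < U) (h : klEngL₄ P R β U ≤ L) :
    2 ^ 61 * klEngPsq P ^ 2 * klEngRsq R ^ 2 * β ^ 3 ≤ U * L := by
  have h1 := klEngL4Real_le_of_klEngL₄_le h
  unfold klEngL4Real at h1
  rw [div_le_iff₀ hU] at h1
  linarith

/-- **The form the (E5-F)ₙ route consumes** ((R47l)): `0 < U → klEngL₄ P R β U ≤ L → 2^55·klEngPsq P²·klEngRsq R²·β³/L ≤ U/64`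
(the `CL`-part of the accumulated (E2″-F) rows is `≤ 2^55·Psq²·Rsq²·β³/L` for `klBetaMin ≤ β`, `n ≤ nScales β + 1` — k3c2-p2's `sum_CL_div_le_of_klEngL₄_le`). -/
theorem beta_cube_div_le_of_klEngL₄_le {P : SplitConsts} {R : RenConsts} {β U : ℝ} {L : ℕ} (hU : 0 < U) (h : klEngL₄ P R β U ≤ L) :
    2 ^ 55 * klEngPsq P ^ 2 * klEngRsq R ^ 2 * β ^ 3 / L ≤ U / 64 := by
  have hL : (0 : ℝ) < L := by exact_mod_cast pos_of_klEngL₄_le h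
  have h1 := mul_le_mul_of_klEngL₄_le hU h
  rw [div_le_div_iff₀ hL (by norm_num : (0 : ℝ) < 64)]
  linarith

/-- Monotonicity of the threshold in the volume: any `L' ≥ L ≥ klEngL₄ P R β U` is above it (bookkeeping for two-volume clauses). -/
theorem klEngL₄_le_trans {P : SplitConsts} {R : RenConsts} {β U : ℝ} {L L' : ℕ} (h : klEngL₄ P R β U ≤ L) (hLL' : L ≤ L') :
    klEngL₄ P R β U ≤ L' :=
  h.trans hLL'

end Summit.HubbardSuperconductivity.HubbardSuperconductivity.Theorems.EngineV8

end
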